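/-
Copyright (c) 2026 The decomp-a2c cell. All rights reserved.
Released under Apache 2.0 license as described in the file LICENSE.
-/
import Summits.AtomisticToContinuum.Crystallization.Theorems.ChartedZeroExcessLayeredLatticeLiouvilleWZ

/-!
# ChartedZeroExcessLayeredLatticeLiouville — part XA «ModalLipschitz»: the thresholds exist; (PC) holds; ★★★ `ModalLipschitzZ` HOLDS
  (decomp-a2c-lens-2, g58; helper of stmt-AtomisticToContinuum-26636 — closes its registered open leaf (LD′) `ModalLipschitzZ` (part VG, critic row 915))

* `load_le_cube`: the scalar heart of the thresholds — for `P, R, G ≥ 0`, `n ≥ 96`, `n ≥ (884736·G·(6P + R))²`, `0 ≤ Nr`, `Nr² ≤ 27n³` and `L ≥ n/96`: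
  `G·(P·n·Nr + R·n/2) ≤ √864·L³` (with `m = √n`: the load is `≤ G(6P + R)m⁵ ≤ m⁶/884736 ≤ L³ ≤ √864·L³`);
* `pc_thresholds`: for every `ϱ ≥ 0` an explicit `n₁(ϱ) > 0` beyond which the six numeric thresholds of WZ `profileComparisonAt_of_thresholds` hold
  (`L' := ⌊n/48⌋₊`);
* ★★★ `profileComparisonAt_holds`: `∃ n₁ > 0, ProfileComparisonAt (pcConst c κ₀ ε) ϱ n₁ a b w` — the typed open leaf (PC) of part WN, with its `ϱ`-FREE
  constant, for every certified laminate in the tail regime;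
* `modalLipschitzAt_mono` (monotonicity in the constant and the scale; `modeRigidAt_mono` is part VG);
* ★★★ `modalLipschitzZ_holds : ModalLipschitzZ` — tail certificate at `ε = κ₀` (as in VZ `modeRigidShape_holds`), the tree's Caccioppoli estimate
  VC `caccioppoli_latDiff` for `hP`, (PC) by `profileComparisonAt_holds`, WN `modalLipschitzAt_of_profileComparison`, VZ `modeRigidAt_of_tail`;
  `C := max (16(4320·ipConst + 3456·gradConst + pcConst)) (rigidConst c₀ (κ₀/2))`, `ϱ₁ := max 1 (max ϱ₀ ϱ_C)`,
  `n₁(ϱ) := max (max n_pc 512(ϱ/c₀+2)) (2·rimDepth+2)`.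

* corollaries `linearExcessDecayZ_holds : LinearExcessDecayZ` (VG `linearExcessDecayZ_of_modalLipschitzZ`) and `interiorDecayCert_holds :
  InteriorDecayCert` (UQ `interiorDecayCert_of_linearExcessDecayZ`) — the leaves (LD′) ⟹ (LD) ⟹ (D₁) of the column of record stmt-AtomisticToContinuum-26636.
-/

namespace Summit.AtomisticToContinuum.Crystallization.Theorems.ChartedZeroExcessLayeredLatticeLiouville

open Summit.AtomisticToContinuum.Crystallization.Theorems.ChartedPlanarOrderRigidityDoor (E3)
open Finset
open scoped InnerProductSpace RealInnerProductSpace BigOperators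

noncomputable section ModalLipschitz

variable {c : ℝ} {a b : E3} {w : ℤ → E3}

/-! ### XA.1  The scalar heart of the thresholds -/

-- `one_le_sqrt_of_le` (1 ≤ √x for 1 ≤ x) restates Literature `…SRWGreen.one_le_sqrt_of_one_le` (gate dedup.landed at landing, hand-2 g27):
-- copy deleted; its two uses below go through `Real.one_le_sqrt` directly; all other statements untouched.

/-- ★ THE SCALAR HEART: `G·(P·n·Nr + R·n/2) ≤ √864·L³` once `n ≥ (884736·G·(6P + R))²`, `n ≥ 96`, `Nr² ≤ 27n³`, `L ≥ n/96`. [this file, g58] -/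
theorem load_le_cube {P R G n Nr L : ℝ} (hP : 0 ≤ P) (hR : 0 ≤ R) (hG : 0 ≤ G) (hQ : (884736 * G * (6 * P + R)) ^ 2 ≤ n) (hn : 96 ≤ n)
    (hNr : 0 ≤ Nr) (hNr2 : Nr ^ 2 ≤ 27 * n ^ 3) (hL : n / 96 ≤ L) : G * (P * n * Nr + R * (n / 2)) ≤ Real.sqrt 864 * L ^ 3 := by
  have hn0 : 0 ≤ n := by linarith
  obtain ⟨m, hm_def⟩ : ∃ m : ℝ, m = Real.sqrt n := ⟨_, rfl⟩
  have hm0 : 0 ≤ m := by rw [hm_def]; exact Real.sqrt_nonneg n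
  have hm1 : 1 ≤ m := by rw [hm_def]; exact Real.one_le_sqrt.mpr (by linarith)
  have en : n = m ^ 2 := by rw [hm_def, Real.sq_sqrt hn0]
  rw [en] at hQ hNr2 hL
  rw [en]
  -- `Nr ≤ 6 m² m`
  have hNr' : Nr ≤ 6 * m ^ 2 * m := by
    have h1 : Nr ^ 2 ≤ (6 * m ^ 2 * m) ^ 2 := by nlinarith [pow_nonneg hm0 6]
    have h2 := Real.sqrt_le_sqrt h1
    rwa [Real.sqrt_sq hNr, Real.sqrt_sq (by positivity)] at h2
  -- `Q ≤ m`
  have hQ0 : 0 ≤ 884736 * G * (6 * P + R) := by positivity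
  have hQm : 884736 * G * (6 * P + R) ≤ m := by
    have h2 := Real.sqrt_le_sqrt hQ
    rwa [Real.sqrt_sq hQ0, Real.sqrt_sq hm0] at h2
  -- `m² ≤ m⁵`
  have h13 : 1 ≤ m ^ 3 := by nlinarith [mul_nonneg (sub_nonneg.mpr hm1) (by positivity : (0 : ℝ) ≤ m ^ 2 + m + 1)]
  have h25 : m ^ 2 ≤ m ^ 5 := by
    calc m ^ 2 = m ^ 2 * 1 := (mul_one _).symm
      _ ≤ m ^ 2 * m ^ 3 := mul_le_mul_of_nonneg_left h13 (sq_nonneg m)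
      _ = m ^ 5 := by ring
  -- `L³ ≥ m⁶ / 884736`
  have hL0 : 0 ≤ m ^ 2 / 96 := by positivity
  have hL3 : (m ^ 2 / 96) ^ 3 ≤ L ^ 3 := pow_le_pow_left₀ hL0 hL 3
  have h864 : (1 : ℝ) ≤ Real.sqrt 864 := Real.one_le_sqrt.mpr (by norm_num)
  have hm5 : 0 ≤ m ^ 5 := pow_nonneg hm0 5
  calc G * (P * m ^ 2 * Nr + R * (m ^ 2 / 2))
      ≤ G * (P * m ^ 2 * (6 * m ^ 2 * m) + R * m ^ 5) := by
        apply mul_le_mul_of_nonneg_left _ hG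
        have h1 : P * m ^ 2 * Nr ≤ P * m ^ 2 * (6 * m ^ 2 * m) := mul_le_mul_of_nonneg_left hNr' (by positivity)
        have h2 : R * (m ^ 2 / 2) ≤ R * m ^ 5 := mul_le_mul_of_nonneg_left (by linarith [sq_nonneg m]) hR
        linarith
    _ = (884736 * G * (6 * P + R)) * m ^ 5 / 884736 := by ring
    _ ≤ m * m ^ 5 / 884736 := by
        have h := mul_le_mul_of_nonneg_right hQm hm5
        linarith
    _ = 1 * (m ^ 2 / 96) ^ 3 := by ring
    _ ≤ Real.sqrt 864 * L ^ 3 := mul_le_mul h864 hL3 (by positivity) (Real.sqrt_nonneg _)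

/-! ### XA.2  The thresholds exist -/

/-- ★★ THE THRESHOLDS EXIST: for every `ϱ ≥ 0` an explicit scale `n₁(ϱ) > 0` beyond which the six numeric thresholds of
WZ `profileComparisonAt_of_thresholds` hold, with `L' := ⌊n/48⌋₊`. [this file, g58] -/
theorem pc_thresholds (hc : 0 < c) {κ₀ ε : ℝ} (hε : ε < 2 * κ₀) {ϱ : ℝ} (hϱ : 0 ≤ ϱ) :
    ∃ n₁ : ℝ, 0 < n₁ ∧ ∀ n : ℝ, n₁ ≤ n → 512 * (ϱ / c + 2) ≤ n / 2 ∧ ∃ L' : ℕ, 1 ≤ L' ∧ 6 * (L' : ℝ) + 3 * (⌊ϱ / c⌋₊ : ℝ) ≤ n / 4 ∧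
      anchorWidth c κ₀ ε + 3 * ⌊ϱ / c⌋₊ ≤ 3 * L' ∧ ∀ Nr : ℝ, 0 ≤ Nr → Nr ^ 2 ≤ 27 * n ^ 3 →
        1372 * kernelConst c * pcLoad c κ₀ ε ϱ n Nr ≤ Real.sqrt 864 * ((L' : ℕ) : ℝ) ^ 3 ∧
        stabConst c (κ₀ - ε / 2) * pcLoad c κ₀ ε ϱ n Nr ≤ Real.sqrt 864 * ((L' : ℕ) : ℝ) ^ 3 := by
  have hδ : 0 < κ₀ - ε / 2 := by linarith
  have hM0 := modeConst_nonneg c hδ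
  have hK0 := kernelConst_nonneg hc
  have hS0 := stabConst_nonneg hc (κ₀ - ε / 2)
  have hR0 := reanchorConst_nonneg hc hε
  have hr0 : (0 : ℝ) ≤ (⌊ϱ / c⌋₊ : ℝ) := Nat.cast_nonneg _
  have hρc : 0 ≤ ϱ / c := div_nonneg hϱ hc.le
  have hrle : (⌊ϱ / c⌋₊ : ℝ) ≤ ϱ / c := Nat.floor_le hρc
  have hA0 : (0 : ℝ) ≤ ((anchorWidth c κ₀ ε : ℕ) : ℝ) := Nat.cast_nonneg _
  have hP0 : (0 : ℝ) ≤ 1 + modeConst c (κ₀ - ε / 2) * kernelConst c * (392 * (⌊ϱ / c⌋₊ : ℝ) + 1186) := by positivity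
  obtain ⟨G, hG_def⟩ : ∃ G : ℝ, G = max (1372 * kernelConst c) (stabConst c (κ₀ - ε / 2)) := ⟨_, rfl⟩
  have hG0 : 0 ≤ G := by rw [hG_def]; exact le_trans (by positivity) (le_max_left _ _)
  have hG1 : 1372 * kernelConst c ≤ G := by rw [hG_def]; exact le_max_left _ _
  have hG2 : stabConst c (κ₀ - ε / 2) ≤ G := by rw [hG_def]; exact le_max_right _ _
  refine ⟨max (max (1024 * (ϱ / c + 2)) (48 * (((anchorWidth c κ₀ ε : ℕ) : ℝ) + 3 * (⌊ϱ / c⌋₊ : ℝ) + 8)))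
    ((884736 * G * (6 * (1 + modeConst c (κ₀ - ε / 2) * kernelConst c * (392 * (⌊ϱ / c⌋₊ : ℝ) + 1186)) + reanchorConst c κ₀ ε)) ^ 2),
    lt_max_of_lt_left (lt_max_of_lt_left (by positivity)), fun n hn => ?_⟩
  have hna : 1024 * (ϱ / c + 2) ≤ n := le_trans (le_trans (le_max_left _ _) (le_max_left _ _)) hn
  have hnb : 48 * (((anchorWidth c κ₀ ε : ℕ) : ℝ) + 3 * (⌊ϱ / c⌋₊ : ℝ) + 8) ≤ n := le_trans (le_trans (le_max_right _ _) (le_max_left _ _)) hn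
  have hnc : (884736 * G * (6 * (1 + modeConst c (κ₀ - ε / 2) * kernelConst c * (392 * (⌊ϱ / c⌋₊ : ℝ) + 1186)) +
      reanchorConst c κ₀ ε)) ^ 2 ≤ n := le_trans (le_max_right _ _) hn
  have hn0 : 0 ≤ n := by linarith
  have hfl : (⌊n / 48⌋₊ : ℝ) ≤ n / 48 := Nat.floor_le (by positivity)
  have hfg : n / 48 < (⌊n / 48⌋₊ : ℝ) + 1 := Nat.lt_floor_add_one (n / 48)
  refine ⟨by linarith, ⌊n / 48⌋₊, ?_, by linarith, ?_, fun Nr hNr hNr2 => ?_⟩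
  · have h : (1 : ℝ) ≤ (⌊n / 48⌋₊ : ℝ) := by linarith
    exact_mod_cast h
  · have h : ((anchorWidth c κ₀ ε : ℕ) : ℝ) + 3 * (⌊ϱ / c⌋₊ : ℝ) ≤ 3 * (⌊n / 48⌋₊ : ℝ) := by linarith
    exact_mod_cast h
  · have hL : n / 96 ≤ (⌊n / 48⌋₊ : ℝ) := by linarith
    have hcore := load_le_cube hP0 hR0 hG0 hnc (by linarith) hNr hNr2 hL
    have hload0 : 0 ≤ pcLoad c κ₀ ε ϱ n Nr := by unfold pcLoad; positivity
    have hcore' : G * pcLoad c κ₀ ε ϱ n Nr ≤ Real.sqrt 864 * ((⌊n / 48⌋₊ : ℕ) : ℝ) ^ 3 := by unfold pcLoad; exact hcore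
    exact ⟨(mul_le_mul_of_nonneg_right hG1 hload0).trans hcore', (mul_le_mul_of_nonneg_right hG2 hload0).trans hcore'⟩

/-! ### XA.3  ★★★ (PC) holds -/

/-- ★★★ THE TYPED OPEN LEAF (PC) OF PART WN HOLDS: `∃ n₁ > 0, ProfileComparisonAt (pcConst c κ₀ ε) ϱ n₁ a b w` with the `ϱ`-FREE constant
`pcConst c κ₀ ε`, for every `κ₀`-coercive `c`-co-Lipschitz layered crystal in the tail regime `(ϱ, ε)` with the Caccioppoli input `hP`.
Parts VV (mode extraction) → WB…WM (the (4a⊥) dictionary) → WQ/WR (slope mismatch, flux drift) → WS/WT/WV (window bootstrap) → WW/WX (anchors)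
→ WY/WZ (profile data, assembly) → XA.1–2 (thresholds). [this file, g58] -/
theorem profileComparisonAt_holds (hc : 0 < c) (hL : IsLayeredCrystal c a b w) {κ₀ ε ϱ : ℝ} (hκ₀ : 0 < κ₀) (hϱ : 0 ≤ ϱ) (hε : ε < 2 * κ₀)
    (hK : CoerciveZ (layeredKernel a b w) κ₀)
    (hT : ∀ φ : Cell 2 → ℤ → E3, HasFiniteSupport φ → Summable (tailFam ϱ a b w φ) ∧ ∑' x, tailFam ϱ a b w φ x ≤ ε * nnFormZ φ)
    (hP : ∀ E₀ : Cell 2 × ℤ, E₀.2 = 0 → (idxNorm E₀ : ℝ) ≤ 1 → ∀ (y₀ : Cell 2 × ℤ) (r' n' : ℝ), r' < n' → ∀ χ : Cell 2 → ℤ → E3,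
      IsTruncHarmonicZ ϱ a b w χ (idxBall y₀ (n' + 1)) →
        κ₀ * idxEnergy (latDiff E₀ χ) (idxBall y₀ r') ≤ 54 * kernelConst c * ((n' - r')⁻¹) ^ 2 * idxEnergy χ (idxBall y₀ (n' + ϱ / c + 1))) :
    ∃ n₁ : ℝ, 0 < n₁ ∧ ProfileComparisonAt (pcConst c κ₀ ε) ϱ n₁ a b w := by
  obtain ⟨n₁, hn₁, hthr⟩ := pc_thresholds hc hε hϱ (κ₀ := κ₀)
  exact ⟨n₁, hn₁, profileComparisonAt_of_thresholds hc hL hκ₀ hϱ hε hK hT hP hthr⟩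

/-! ### XA.4  Monotonicity of the modal leaf predicate (`modeRigidAt_mono` is part VG) -/

/-- `ModalLipschitzAt` is monotone in the constant and the scale. [formal bookkeeping] -/
theorem modalLipschitzAt_mono {C C' ϱ n₁ n₁' : ℝ} (hC : C ≤ C') (hn : n₁ ≤ n₁') (h : ModalLipschitzAt C ϱ n₁ a b w) :
    ModalLipschitzAt C' ϱ n₁' a b w := by
  intro φ x₀ n hn' hφ
  obtain ⟨M, hM, hb⟩ := h φ x₀ n (hn.trans hn') hφ
  refine ⟨M, hM, fun X Y hX hY hXY => (hb X Y hX hY hXY).trans ?_⟩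
  exact mul_le_mul_of_nonneg_right (mul_le_mul_of_nonneg_right hC (sq_nonneg _)) (idxEnergy_nonneg _ _)

/-! ### XA.5  ★★★ `ModalLipschitzZ` holds -/

/-- ★★★ **(LD′) `ModalLipschitzZ` HOLDS** — the registered open leaf of stmt-AtomisticToContinuum-26636 (part VG; critic row 915):
given the tail certificate, for all `(κ₀, c₀, C₁)` there are `C ≥ 1` (here `max (16(4320·ipConst c₀ κ₀ κ₀ + 3456·gradConst c₀ κ₀ κ₀ +
pcConst c₀ κ₀ κ₀)) (rigidConst c₀ (κ₀/2))`, INDEPENDENT of `ϱ`), `ϱ₁ = max 1 (max ϱ₀ ϱ_C) ≥ 1` and, per `ϱ ≥ ϱ₁`, ONE scale `n₁(ϱ) > 0` such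
that every `c₀`-co-Lipschitz
`κ₀`-coercive layered crystal satisfies `ModalLipschitzAt C ϱ n₁ ∧ ModeRigidAt C ϱ n₁` (tameness is not used).  Tail certificate at `ε = κ₀`;
`hP` = VC `caccioppoli_latDiff`; (PC) = `profileComparisonAt_holds`; WN `modalLipschitzAt_of_profileComparison`; VZ `modeRigidAt_of_tail`.
[this file, g58] -/
theorem modalLipschitzZ_holds : ModalLipschitzZ := by
  intro hTD κ₀ hκ₀ c₀ hc₀ C₁ _hC₁
  obtain ⟨ϱ₀, _, hTail⟩ := hTD c₀ hc₀ κ₀ hκ₀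
  obtain ⟨ϱC, _, hCacc⟩ := caccioppoli_latDiff (c := c₀) hc₀ hκ₀
  have hε : κ₀ < 2 * κ₀ := by linarith
  refine ⟨max (16 * (4320 * ipConst c₀ κ₀ κ₀ + 3456 * gradConst c₀ κ₀ κ₀ + pcConst c₀ κ₀ κ₀)) (rigidConst c₀ (κ₀ - κ₀ / 2)),
    le_trans (by linarith [twelve_le_rigidConst c₀ (κ₀ - κ₀ / 2)]) (le_max_right _ _), max 1 (max ϱ₀ ϱC), le_max_left _ _, ?_⟩
  intro ϱ hϱ
  have hϱ0 : 0 ≤ ϱ := zero_le_one.trans ((le_max_left _ _).trans hϱ)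
  have hϱ₀ϱ : ϱ₀ ≤ ϱ := ((le_max_left _ _).trans (le_max_right _ _)).trans hϱ
  have hϱCϱ : ϱC ≤ ϱ := ((le_max_right _ _).trans (le_max_right _ _)).trans hϱ
  obtain ⟨npc, hnpc, hthr⟩ := pc_thresholds hc₀ hε hϱ0 (κ₀ := κ₀)
  refine ⟨max (max npc (512 * (ϱ / c₀ + 2))) ((((2 * rimDepth c₀ (κ₀ - κ₀ / 2) + 2 : ℕ)) : ℝ)),
    lt_max_of_lt_left (lt_max_of_lt_left hnpc), ?_⟩
  intro a b w hL _hI hK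
  have hT : ∀ φ : Cell 2 → ℤ → E3, HasFiniteSupport φ →
      Summable (tailFam ϱ a b w φ) ∧ ∑' x, tailFam ϱ a b w φ x ≤ κ₀ * nnFormZ φ :=
    fun φ hφ => hTail ϱ hϱ₀ϱ a b w hL φ hφ
  have hP : ∀ E₀ : Cell 2 × ℤ, E₀.2 = 0 → (idxNorm E₀ : ℝ) ≤ 1 → ∀ (y₀ : Cell 2 × ℤ) (r' n' : ℝ), r' < n' → ∀ χ : Cell 2 → ℤ → E3,
      IsTruncHarmonicZ ϱ a b w χ (idxBall y₀ (n' + 1)) →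
        κ₀ * idxEnergy (latDiff E₀ χ) (idxBall y₀ r') ≤ 54 * kernelConst c₀ * ((n' - r')⁻¹) ^ 2 * idxEnergy χ (idxBall y₀ (n' + ϱ / c₀ + 1)) :=
    fun E₀ hE hE1 y₀ r' n' hrn χ hχ => hCacc ϱ hϱCϱ a b w hL hK E₀ hE hE1 y₀ r' n' hrn χ hχ
  have hPC := profileComparisonAt_of_thresholds hc₀ hL hκ₀ hϱ0 hε hK hT hP hthr
  have hpc0 : 0 ≤ pcConst c₀ κ₀ κ₀ := sq_nonneg _
  have hML := modalLipschitzAt_of_profileComparison hc₀ hL hκ₀ hϱ0 hε hK hT hP hpc0 hPC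
  have hMR := modeRigidAt_of_tail hc₀ hL hϱ0 hε hK hT
  exact ⟨modalLipschitzAt_mono (le_max_left _ _) (le_max_left _ _) hML, modeRigidAt_mono (le_max_right _ _) (le_max_right _ _) hMR⟩

/-- (LD) `LinearExcessDecayZ` HOLDS — by the tree's VG `linearExcessDecayZ_of_modalLipschitzZ`. [this file, g58] -/
theorem linearExcessDecayZ_holds : LinearExcessDecayZ :=
  linearExcessDecayZ_of_modalLipschitzZ modalLipschitzZ_holds

/-- (D₁) `InteriorDecayCert` HOLDS — by the tree's UQ `interiorDecayCert_of_linearExcessDecayZ`. [this file, g58] -/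
theorem interiorDecayCert_holds : InteriorDecayCert :=
  interiorDecayCert_of_linearExcessDecayZ linearExcessDecayZ_holds

/-! ### XA.6  The closed statement of this part -/

/-- The content of part XA as one closed proposition: (PC) with the `ϱ`-free constant, (LD′) `ModalLipschitzZ`, (LD), (D₁). -/
def ModalLipschitzShape : Prop :=
  (∀ c : ℝ, ∀ hc : 0 < c, ∀ (a b : E3) (w : ℤ → E3), ∀ hL : IsLayeredCrystal c a b w, ∀ κ₀ ε ϱ : ℝ, 0 < κ₀ → 0 ≤ ϱ → ε < 2 * κ₀ →
    CoerciveZ (layeredKernel a b w) κ₀ →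
    (∀ φ : Cell 2 → ℤ → E3, HasFiniteSupport φ → Summable (tailFam ϱ a b w φ) ∧ ∑' x, tailFam ϱ a b w φ x ≤ ε * nnFormZ φ) →
    (∀ E₀ : Cell 2 × ℤ, E₀.2 = 0 → (idxNorm E₀ : ℝ) ≤ 1 → ∀ (y₀ : Cell 2 × ℤ) (r' n' : ℝ), r' < n' → ∀ χ : Cell 2 → ℤ → E3,
      IsTruncHarmonicZ ϱ a b w χ (idxBall y₀ (n' + 1)) →
        κ₀ * idxEnergy (latDiff E₀ χ) (idxBall y₀ r') ≤ 54 * kernelConst c * ((n' - r')⁻¹) ^ 2 * idxEnergy χ (idxBall y₀ (n' + ϱ / c + 1))) →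
    ∃ n₁ : ℝ, 0 < n₁ ∧ ProfileComparisonAt (pcConst c κ₀ ε) ϱ n₁ a b w) ∧
  ModalLipschitzZ ∧ LinearExcessDecayZ ∧ InteriorDecayCert

/-- XA holds. [this file, g58] -/
theorem modalLipschitzShape_holds : ModalLipschitzShape :=
  ⟨fun _c hc _a _b _w hL _κ₀ _ε _ϱ hκ₀ hϱ hε hK hT hP => profileComparisonAt_holds hc hL hκ₀ hϱ hε hK hT hP, modalLipschitzZ_holds,
    linearExcessDecayZ_holds, interiorDecayCert_holds⟩

end ModalLipschitz

end Summit.AtomisticToContinuum.Crystallization.Theorems.ChartedZeroExcessLayeredLatticeLiouville
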